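import Summits.QuantumFields.BalabanUV.T4Continuum.Support.NE7SliceLetterCover
import Summits.QuantumFields.BalabanUV.T4Continuum.Support.NE7FlatSliceSourceDuality
import HarnessLib

/-!
# NE7SliceLetterCoverSource — THE SOURCE-FORM SLICE-SOLVER LETTER (F148's currency) LIFTS DOWN FROM EVERY COVER OF THE TORUS: the source identity
# `hess W X Y (perWin P) = ⟨H, Y⟩` on the `P`-periodic tangent tests implies it on the `P·m`-periodic tangent tests over the cover window, so the
# source letter at period `L^{k+1}·(N·m)` implies the source letter at period `L^{k+1}·N`, same constants (file 80 of the curved (APE), F150; companion of F149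
# `NE7SliceLetterCover`)

Cell `pub-balaban`, rung (B)+1 sub-cell t4, lineage `b2b-balaban-t4-ne7-p1` (CRUX PROVER NE7 #1 = OWNER of row NE7), generation 82; memo
`t4/b2b-balaban-t4-ne7-p1-g82/LOCALISATION-ROAD.md` §3.  Over F149 `NE7SliceLetterCover` (deck sums `Ȳ = Σ_{s∈[0,m)^d} Y(· + P•s)`: `hess_deck_eq`, `isSkewDir_deck`,
`isPeriodicDir_deck`, `dirIter_deck_eq_zero`) and lineage #2's `NE7FlatSliceSourceDuality.srcPair`.
WHAT ([folklore]; 0 def, 0 sorry).  §1 `srcPair_deck_eq`: `⟨H, Ȳ⟩_{[0,P)^d} = ⟨H, Y⟩_{[0,P·m)^d}` for `P`-periodic `H`; §2 **`srcIdentity_cover`** (the source identity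
lifts to the cover); §3 **`sourceLetter_cover`** — for ANY period-free side condition `C` and constants `(K_G, K_X)`: F148's source letter at period `L^{k+1}·(N·m)`
implies the source letter at period `L^{k+1}·N`.
HONEST FRAMING (page 1): elementary lattice bookkeeping BY NAME; no estimate; (c₁) NOT proved, asserted for no datum; nothing of Bałaban's asserted; (APE) on
curved data NOT proved; NOT ONE-STEP, NOT NE7; spine 0∕9; finite T⁴ rung (B)+1 — NOT infinite volume, NOT mass gap, NOT `BetaPertH`, NOT Clay.  Continuum YM on
T⁴ ⇐ BetaPertH ∧ nine spine estimates (0/9 proved); BetaPertH ⇐ (D1) ∧ (D4) ∧ CAP+tail; G-an2-4 gates asym, D1 and NE2/3/4.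
-/

set_option autoImplicit false

open scoped BigOperators Matrix.Norms.L2Operator
open Finset

namespace Summit.QuantumFields.BalabanUV.T4Continuum.NE7SliceLetterCoverSource

open Literature.MathematicalPhysics.QuantumFieldTheory.Balaban1983to89
open B7Prop1Explicit B7Prop2Explicit UnitaryModel
open T4AveragingDeficitWall (IsUnitaryCfg IsSkewDir SmallField curlAt dirL1 nReTrL nReTrL_apply)
open T4AveragingDeficitWallBoundary (IsPeriodicCfg periodBox mem_periodBox)
open AveragingDeficitPeriodicCounting (IsPeriodicDir)
open AveragingDeficitMultiLevelPrep (LevelSmall)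
open MinimalActionLevels (perWin)
open NE3HessForm (hess)
open NE3TangentCovariantTower (dirIter)
open NE3CovariantCalculus (hsR)
open NE7FlatSliceSourceDuality (srcPair)
open NE7TangentCriticalCover (isPeriodicCfg_mul isPeriodicDir_mul)
open NE3BlockLineAverage (sum_periodBox_blocks)
open PeriodicChoice (periodic_vec)
open NE7SliceLetterCover (isSkewDir_deck isPeriodicDir_deck dirIter_deck_eq_zero hess_deck_eq)

noncomputable section

variable {d : ℕ} {n : Type*} [Fintype n] [DecidableEq n]

/-! ## §1 The source pairing against the deck sum -/

omit [DecidableEq n] in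
/-- The source pairing of a `P`-periodic source against the deck sum over the period box equals the pairing against the test over the cover box:
`⟨H, Ȳ⟩_{[0,P)^d} = ⟨H, Y⟩_{[0,P·m)^d}`. [folklore] -/
theorem srcPair_deck_eq {P : ℕ} (hP : 1 ≤ P) (m : ℕ) {H : Site d → Fin d → Matrix n n ℂ} (hH : IsPeriodicDir H (P : ℤ))
    (φ : Site d → Fin d → Matrix n n ℂ) :
    srcPair H (fun y μ => ∑ s ∈ periodBox (d := d) m, φ (y + (P : ℤ) • s) μ) (periodBox (d := d) P)
      = srcPair H φ (periodBox (d := d) (P * m)) := by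
  unfold NE7FlatSliceSourceDuality.srcPair
  have hlin : ∀ (y : Site d) (κ : Fin d),
      hsR (H y κ) (∑ s ∈ periodBox (d := d) m, φ (y + (P : ℤ) • s) κ) = ∑ s ∈ periodBox (d := d) m, hsR (H y κ) (φ (y + (P : ℤ) • s) κ) := by
    intro y κ
    unfold NE3CovariantCalculus.hsR
    rw [Finset.mul_sum, ← nReTrL_apply, map_sum]
    simp only [nReTrL_apply]
  simp_rw [hlin]
  rw [← sum_periodBox_blocks P m hP (fun w => ∑ κ : Fin d, hsR (H w κ) (φ w κ))]
  calc ∑ x ∈ periodBox (d := d) P, ∑ κ : Fin d, ∑ s ∈ periodBox (d := d) m, hsR (H x κ) (φ (x + (P : ℤ) • s) κ)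
      = ∑ x ∈ periodBox (d := d) P, ∑ s ∈ periodBox (d := d) m, ∑ κ : Fin d, hsR (H x κ) (φ (x + (P : ℤ) • s) κ) := by
        refine Finset.sum_congr rfl fun x _ => ?_
        rw [Finset.sum_comm]
    _ = ∑ s ∈ periodBox (d := d) m, ∑ x ∈ periodBox (d := d) P, ∑ κ : Fin d, hsR (H x κ) (φ (x + (P : ℤ) • s) κ) := Finset.sum_comm
    _ = ∑ s ∈ periodBox (d := d) m, ∑ v ∈ periodBox (d := d) P, ∑ κ : Fin d, hsR (H ((P : ℤ) • s + v) κ) (φ ((P : ℤ) • s + v) κ) := by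
        refine Finset.sum_congr rfl fun s _ => Finset.sum_congr rfl fun v _ => Finset.sum_congr rfl fun κ _ => ?_
        have hHv : H ((P : ℤ) • s + v) κ = H v κ := by
          rw [add_comm]
          have h := periodic_vec (g := H) (N := (P : ℤ)) (fun y κ' => funext fun ν => hH y κ' ν) v s
          exact congr_fun h κ
        rw [hHv, add_comm v]

/-! ## §2 The source identity lifts to the cover -/

/-- **THE SOURCE IDENTITY LIFTS TO EVERY COVER.**  For unitary `U` of period `P = L^{k+1}·N` in the class, `P`-periodic `X` and `H`: if
`hess U X Y (perWin P) = ⟨H, Y⟩_{[0,P)^d}` for every skew `P`-periodic `U`-tangent `Y`, then for every `m ≥ 1` and every skew `P·m`-periodic `U`-tangent `Y`,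
`hess U X Y (perWin (P·m)) = ⟨H, Y⟩_{[0,P·m)^d}`. [folklore] -/
theorem srcIdentity_cover [Nonempty n] {L : ℕ} (hL : 1 ≤ L) (k : ℕ) {N : ℕ} (hN : 1 ≤ N) {m : ℕ} (hm : 1 ≤ m)
    {U : Site d → Fin d → (Matrix n n ℂ)ˣ} (hU : IsUnitaryCfg U) {x : ℝ} (hx : 0 ≤ x) (hs : LevelSmall d L k x) (hUx : SmallField U x)
    (hUP : IsPeriodicCfg U ((L ^ (k + 1) * N : ℕ) : ℤ))
    {X H : Site d → Fin d → Matrix n n ℂ} (hXP : IsPeriodicDir X ((L ^ (k + 1) * N : ℕ) : ℤ)) (hHP : IsPeriodicDir H ((L ^ (k + 1) * N : ℕ) : ℤ))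
    (hXH : ∀ Y : Site d → Fin d → Matrix n n ℂ, IsSkewDir Y → IsPeriodicDir Y ((L ^ (k + 1) * N : ℕ) : ℤ) → dirIter L (k + 1) U Y = 0 →
      hess U X Y (perWin d (L ^ (k + 1) * N)) = srcPair H Y (periodBox (d := d) (L ^ (k + 1) * N))) :
    ∀ Y : Site d → Fin d → Matrix n n ℂ, IsSkewDir Y → IsPeriodicDir Y ((L ^ (k + 1) * (N * m) : ℕ) : ℤ) → dirIter L (k + 1) U Y = 0 →
      hess U X Y (perWin d (L ^ (k + 1) * (N * m))) = srcPair H Y (periodBox (d := d) (L ^ (k + 1) * (N * m))) := by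
  intro Y hYs hYP hYT
  set P : ℕ := L ^ (k + 1) * N with hPdef
  have hPm : L ^ (k + 1) * (N * m) = P * m := by rw [hPdef, Nat.mul_assoc]
  rw [hPm] at hYP ⊢
  have hL0 : 0 < L := hL
  have hP1 : 1 ≤ P := Nat.one_le_iff_ne_zero.mpr (Nat.mul_ne_zero (pow_ne_zero _ hL0.ne') (by omega))
  set Ybar : Site d → Fin d → Matrix n n ℂ := fun y μ => ∑ s ∈ periodBox (d := d) m, Y (y + (P : ℤ) • s) μ with hYbar
  have hbs : IsSkewDir Ybar := isSkewDir_deck hYs (P : ℤ) m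
  have hbP : IsPeriodicDir Ybar (P : ℤ) := isPeriodicDir_deck hm hYP
  have hbT : dirIter L (k + 1) U Ybar = 0 := dirIter_deck_eq_zero hL k m hU hx hs hUx hUP hYT
  rw [hess_deck_eq hP1 hm hUP hXP hYP, hXH Ybar hbs hbP hbT]
  exact srcPair_deck_eq hP1 m hHP Y

/-! ## §3 The source-form letter lifts down from the cover -/

/-- **THE SOURCE-FORM LETTER LIFTS DOWN FROM THE `m`-FOLD COVER** (F148's currency: skew periodic source `H` with `‖H‖_∞ ≤ g` and the source IDENTITY on the
tangent tests).  Same shape as `sliceLetter_cover`. [folklore] -/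
theorem sourceLetter_cover [Nonempty n] {L : ℕ} (hL : 1 ≤ L) (k : ℕ) {N : ℕ} (hN : 1 ≤ N) {m : ℕ} (hm : 1 ≤ m)
    {W : Site d → Fin d → (Matrix n n ℂ)ˣ} (hWu : IsUnitaryCfg W) {x : ℝ} (hx : 0 ≤ x) (hs : LevelSmall d L k x) (hWx : SmallField W x)
    (hWP : IsPeriodicCfg W ((L ^ (k + 1) * N : ℕ) : ℤ))
    (C : (Site d → Fin d → Matrix n n ℂ) → Prop) {KG KX : ℝ}
    (hbig : ∀ X : Site d → Fin d → Matrix n n ℂ, IsSkewDir X → C X →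
      IsPeriodicDir X ((L ^ (k + 1) * (N * m) : ℕ) : ℤ) → dirIter L (k + 1) W X = 0 → ∀ R : ℝ, (∀ y κ', ‖X y κ'‖ ≤ R) →
      ∀ H : Site d → Fin d → Matrix n n ℂ, IsSkewDir H → IsPeriodicDir H ((L ^ (k + 1) * (N * m) : ℕ) : ℤ) → ∀ g : ℝ, 0 ≤ g →
      (∀ (y : Site d) (κ : Fin d), ‖H y κ‖ ≤ g) →
      (∀ Y : Site d → Fin d → Matrix n n ℂ, IsSkewDir Y → IsPeriodicDir Y ((L ^ (k + 1) * (N * m) : ℕ) : ℤ) → dirIter L (k + 1) W Y = 0 →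
        hess W X Y (perWin d (L ^ (k + 1) * (N * m))) = srcPair H Y (periodBox (d := d) (L ^ (k + 1) * (N * m)))) →
      ∀ z μ' ν', μ' ≠ ν' → ‖curlAt W X z μ' ν'‖ ≤ KG * g + KX * R) :
    ∀ X : Site d → Fin d → Matrix n n ℂ, IsSkewDir X → C X →
      IsPeriodicDir X ((L ^ (k + 1) * N : ℕ) : ℤ) → dirIter L (k + 1) W X = 0 → ∀ R : ℝ, (∀ y κ', ‖X y κ'‖ ≤ R) →
      ∀ H : Site d → Fin d → Matrix n n ℂ, IsSkewDir H → IsPeriodicDir H ((L ^ (k + 1) * N : ℕ) : ℤ) → ∀ g : ℝ, 0 ≤ g →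
      (∀ (y : Site d) (κ : Fin d), ‖H y κ‖ ≤ g) →
      (∀ Y : Site d → Fin d → Matrix n n ℂ, IsSkewDir Y → IsPeriodicDir Y ((L ^ (k + 1) * N : ℕ) : ℤ) → dirIter L (k + 1) W Y = 0 →
        hess W X Y (perWin d (L ^ (k + 1) * N)) = srcPair H Y (periodBox (d := d) (L ^ (k + 1) * N))) →
      ∀ z μ' ν', μ' ≠ ν' → ‖curlAt W X z μ' ν'‖ ≤ KG * g + KX * R := by
  intro X hXs hXC hXP hXT R hXR H hHs hHP g hg hHg hXH z μ' ν' hne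
  have hXPm : IsPeriodicDir X ((L ^ (k + 1) * (N * m) : ℕ) : ℤ) := by
    have h := isPeriodicDir_mul hXP (m : ℤ)
    push_cast at h ⊢
    rw [mul_assoc] at h
    exact h
  have hHPm : IsPeriodicDir H ((L ^ (k + 1) * (N * m) : ℕ) : ℤ) := by
    have h := isPeriodicDir_mul hHP (m : ℤ)
    push_cast at h ⊢
    rw [mul_assoc] at h
    exact h
  exact hbig X hXs hXC hXPm hXT R hXR H hHs hHPm g hg hHg (srcIdentity_cover hL k hN hm hWu hx hs hWx hWP hXP hHP hXH) z μ' ν' hne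

end

end Summit.QuantumFields.BalabanUV.T4Continuum.NE7SliceLetterCoverSource
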